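import Mathlib
import HarnessLib
import Literature.Analysis.FluidPDE.Tao2016AveragedNS.LocalCascadeSolutions
import Literature.Analysis.FluidPDE.Tao2016AveragedNS.RenormalisedCascadeWaves
import Literature.Analysis.FluidPDE.Tao2016AveragedNS.ViscousEternalSolutions
import Literature.Analysis.FluidPDE.Tao2016AveragedNS.BoundedEternalSolutions
import Summits.NavierStokesRegularity.NavierStokesRegularity.Theorems.TaoLadderRungTwoBreakNoSurvivingEternalViscBddOneTailSlaving
import Summits.NavierStokesRegularity.NavierStokesRegularity.Theorems.WakeRatchetTailRatchetEternalGapVisc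

/-!
# Crux K1ᵛ(1) `TaoLadderRungTwoBreak.NoSurvivingEternalViscBddOne` (stmt-NavierStokesRegularity-20419):
# the ACTION form of the slaving — a shell's log-time action is paid by the SQUARED action of the shell
# below; LARGE ACTION FORCES THE SHELL BELOW TO BE LOUD

MODEL lattice ODEs only (Tao 2016 §4 in the self-similar log-time variables of §6.4); nothing in this file
is a statement about the Navier–Stokes equations, and no summit or rung LEAF is proved by it
(`--supports stmt-NavierStokesRegularity-20419 --as helper`).  General `m`, any cancelling table, every
`ε₀ > 0`, every `ν̂ ≥ 0`; `C_A = fluxConst α`, `Λ = bigLam ε₀`.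

The fence of `…TailSlaving` bounds the AMPLITUDE of a shell by the squared amplitude of the shell below.
The crux's bookkeeping (tree `…TailConveyor`: survival ⇒ infinitely many bonds with action
`∫‖W_{n+1}‖ > θΛ/(2C_A(1+ε₀))`; `…UpwardFluxOrthant`: the dyadic member survives only at action
`> log(1/ε₀)/512`) is in ACTION currency.  This file converts: the Duhamel / `L¹` form of the fence.

* `deriv_normSq_le_linear` — pointwise: when the back-reaction eats at most half the damping
  (`-2Λ⁻¹⟪W_{k+1}, A W_k⟫ ≤ ½‖W_k‖²`; implied by the margin `4 C_A ‖W_{k+1}‖ ≤ Λ` or by an upward flux),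
  `(‖W_k‖²)' ≤ -(3/2)‖W_k‖² + 2 (Λ C_A ‖W_{k-1}‖²) ‖W_k‖` — LINEAR in `‖W_k‖`, which is what an `L¹` bound needs.
* `action_le_of_halfBack` — THE ACTION FENCE on an interval `[s₀, σ₁]`:
  `(3/4) ∫_{s₀}^{σ₁} ‖W_k‖ ≤ ‖W_k(s₀)‖ + Λ C_A ∫_{s₀}^{σ₁} ‖W_{k-1}‖²`
  (regularise `g_η = √(‖W_k‖² + η)`, which obeys the linear inequality `g_η' ≤ -(3/4) g_η + (3/4)√η + ΛC_A‖W_{k-1}‖²`;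
  the functional `g_η + (3/4)∫g_η - ∫b - (3/4)√η·(σ - s₀)` is antitone; let `η → 0`).  Wrappers
  `action_le_slaved` (margin) and `action_le_slaved_of_flux_nonneg` (sign-coherent bond).
* `action_le_sup_mul_action` — hence `(3/4)·A_k ≤ ‖W_k(s₀)‖ + Λ C_A · M_{k-1} · A_{k-1}` with `A_j` the actions on
  `[s₀, σ₁]` and `M_{k-1}` the sup of `‖W_{k-1}‖` there: **a bond can be expensive only if the shell below is
  LOUD** (`M_{k-1} ≥ ((3/4)A_k - ‖W_k(s₀)‖)/(ΛC_A A_{k-1})`), and on a quiet tail the actions decay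
  super-exponentially up the ladder (`A_k ≤ (4/3)(‖W_k(s₀)‖ + ΛC_A δ_{k-1} A_{k-1})`).

READING (census ⟨20419⟩ (T1) of CENSUS-20419-leafhand-5-g0): combined BY NAME with `…TailConveyor`'s
`frequently_largeAction_of_survivingFwd`, (S₁)-survival of a bounded admissible eternal solution forces infinitely
many shells to reach amplitude `≳ Λ²/(C_A²(1+ε₀)·M)` (`M` = the action bound) — survival is LOUD in amplitude,
shell after shell; with the loud down-set (`…TailBarrier`, `…TailBarrierOrthant`) every shell of a surviving
solution of the orthant class / of a viscous one is loud.  HONEST LABEL: structure lemmas; the stubs and ⟨20419⟩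
stay OPEN; rung 0.
-/

noncomputable section

-- the summit and its single sub-problem share the name (CONVENTIONS §1)
set_option linter.dupNamespace false

namespace Summit.NavierStokesRegularity.NavierStokesRegularity.Theorems.NoSurvivingEternalViscBddOne.TailBarrier

open Set Filter Topology MeasureTheory intervalIntegral
open scoped RealInnerProductSpace
open Literature.Analysis.FluidPDE Literature.Analysis.FluidPDE.TaoCascade
open Summit.NavierStokesRegularity.NavierStokesRegularity.Theorems.WakeRatchetEternalGapVisc (hasDerivAt_norm_sq_visc)

variable {m : ℕ} {ε₀ νh : ℝ} {α : Fin m → Fin m → Fin m → ℤ × ℤ × ℤ → ℝ} {W : ℤ → ℝ → Em m}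

/-! ## The shell energy derivative, linear form (the plain identity is the tree's
`WakeRatchetEternalGapVisc.hasDerivAt_norm_sq_visc`) -/

/-- **Linear form of the bracket bound.**  If at log-time `σ` the back-reaction into shell `k` eats at most half
the damping (`-(2Λ⁻¹⟪W_{k+1}, A W_k⟫) ≤ ‖W_k‖²/2`), then
`(‖W_k‖²)'(σ) ≤ -(3/2)‖W_k(σ)‖² + 2 (Λ C_A ‖W_{k-1}(σ)‖²) ‖W_k(σ)‖`.
[cite: Tao2016AveragedNS, §4 (4.1), (4.3), Lemma 4.1 (4.8); §6.4] -/
theorem deriv_normSq_le_linear (hε : 0 < ε₀) (hν : 0 ≤ νh) (hc : IsCancellingCoeff α) {k : ℤ} {σ : ℝ}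
    (hback : -(2 * (bigLam ε₀)⁻¹ * ⟪W (k + 1) σ, tableA α (W k σ)⟫) ≤ ‖W k σ‖ ^ 2 / 2) :
    -2 * ‖W k σ‖ ^ 2 + 2 * bigLam ε₀ * ⟪W k σ, tableA α (W (k - 1) σ)⟫
        - 2 * (bigLam ε₀)⁻¹ * ⟪W (k + 1) σ, tableA α (W k σ)⟫
        - 2 * viscCoef ε₀ νh k σ * ‖W k σ‖ ^ 2
      ≤ -(3 / 2) * ‖W k σ‖ ^ 2
        + 2 * (bigLam ε₀ * fluxConst α * ‖W (k - 1) σ‖ ^ 2) * ‖W k σ‖ := by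
  have hS := table_sTable α hc
  have hΛ : 0 < bigLam ε₀ := bigLam_pos (by linarith)
  have hfeed : ⟪W k σ, tableA α (W (k - 1) σ)⟫ ≤ ‖W k σ‖ * (fluxConst α * ‖W (k - 1) σ‖ ^ 2) :=
    (real_inner_le_norm _ _).trans (mul_le_mul_of_nonneg_left (hS.normA _) (norm_nonneg _))
  have hfeed' : 2 * bigLam ε₀ * ⟪W k σ, tableA α (W (k - 1) σ)⟫
      ≤ 2 * bigLam ε₀ * (‖W k σ‖ * (fluxConst α * ‖W (k - 1) σ‖ ^ 2)) :=
    mul_le_mul_of_nonneg_left hfeed (by positivity)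
  have hvisc : 0 ≤ 2 * viscCoef ε₀ νh k σ * ‖W k σ‖ ^ 2 := by
    have hvc : 0 ≤ viscCoef ε₀ νh k σ := by
      unfold viscCoef
      have : 0 < (1 + ε₀) ^ ((2 : ℝ) * k) := Real.rpow_pos_of_pos (by linarith) _
      positivity
    positivity
  nlinarith

/-! ## The action fence -/

/-- **THE ACTION FENCE (Duhamel form of the slaving; any `ν̂ ≥ 0`).**  Let `W` be an admissible eternal solution with
covariant viscosity of a cancelling table, `k` a shell and `s₀ ≤ σ₁`.  If on `[s₀, σ₁]` the back-reaction into
shell `k` eats at most half the damping, then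
`(3/4) ∫_{s₀}^{σ₁} ‖W_k‖ ≤ ‖W_k(s₀)‖ + Λ C_A ∫_{s₀}^{σ₁} ‖W_{k-1}‖²`.
[cite: Tao2016AveragedNS, §4 (4.1), (4.3), Lemma 4.1 (4.8); §6.4 (self-similar variables)] -/
theorem action_le_of_halfBack (hε : 0 < ε₀) (hW : IsEternalVisc ε₀ νh α W) (hc : IsCancellingCoeff α)
    {k : ℤ} {s₀ σ₁ : ℝ} (hs : s₀ ≤ σ₁)
    (hback : ∀ s, s₀ ≤ s → s ≤ σ₁ →
      -(2 * (bigLam ε₀)⁻¹ * ⟪W (k + 1) s, tableA α (W k s)⟫) ≤ ‖W k s‖ ^ 2 / 2) :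
    (3 / 4) * ∫ s in s₀..σ₁, ‖W k s‖
      ≤ ‖W k s₀‖ + bigLam ε₀ * fluxConst α * ∫ s in s₀..σ₁, ‖W (k - 1) s‖ ^ 2 := by
  have hΛ : 0 < bigLam ε₀ := bigLam_pos (by linarith)
  have hCA : 0 ≤ fluxConst α := fluxConst_nonneg α
  have hcont : ∀ j : ℤ, Continuous (W j) := fun j =>
    continuous_iff_continuousAt.2 fun x => (hW.law j x).continuousAt
  -- the source b(s) = Λ C_A ‖W_{k-1}(s)‖²
  set b : ℝ → ℝ := fun s => bigLam ε₀ * fluxConst α * ‖W (k - 1) s‖ ^ 2 with hb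
  have hbcont : Continuous b := by
    simp only [hb]; exact continuous_const.mul ((hcont (k - 1)).norm.pow 2)
  have hb0 : ∀ s, 0 ≤ b s := fun s => by simp only [hb]; positivity
  have hucont : Continuous fun s => ‖W k s‖ := (hcont k).norm
  -- it suffices to prove the bound up to ε
  refine le_of_forall_pos_le_add fun δ hδ => ?_
  -- choose the regularisation η with √η (1 + (3/4)(σ₁ - s₀)) ≤ δ
  set L : ℝ := 1 + (3 / 4) * (σ₁ - s₀) with hL
  have hL0 : 0 < L := by rw [hL]; nlinarith
  set r : ℝ := δ / L with hr
  have hr0 : 0 < r := div_pos hδ hL0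
  set η : ℝ := r ^ 2 with hη
  have hη0 : 0 < η := by positivity
  have hsqη : Real.sqrt η = r := by rw [hη, Real.sqrt_sq hr0.le]
  -- the regularised amplitude
  set g : ℝ → ℝ := fun s => Real.sqrt (‖W k s‖ ^ 2 + η) with hg
  have hgcont : Continuous g := by
    simp only [hg]; exact (((hcont k).norm.pow 2).add continuous_const).sqrt
  have hgpos : ∀ s, 0 < g s := fun s => by
    show 0 < Real.sqrt (‖W k s‖ ^ 2 + η)
    exact Real.sqrt_pos.2 (by positivity)
  have hug : ∀ s, ‖W k s‖ ≤ g s := fun s => by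
    show ‖W k s‖ ≤ Real.sqrt (‖W k s‖ ^ 2 + η)
    calc ‖W k s‖ = Real.sqrt (‖W k s‖ ^ 2) := (Real.sqrt_sq (norm_nonneg _)).symm
      _ ≤ Real.sqrt (‖W k s‖ ^ 2 + η) := Real.sqrt_le_sqrt (by linarith)
  have hrg : ∀ s, r ≤ g s := fun s => by
    show r ≤ Real.sqrt (‖W k s‖ ^ 2 + η)
    rw [← hsqη]; exact Real.sqrt_le_sqrt (le_add_of_nonneg_left (by positivity))
  have hgs₀ : g s₀ ≤ ‖W k s₀‖ + r := by
    show Real.sqrt (‖W k s₀‖ ^ 2 + η) ≤ ‖W k s₀‖ + r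
    rw [Real.sqrt_le_left (by positivity)]
    nlinarith [norm_nonneg (W k s₀), hr0.le]
  -- derivative of g
  have hgderiv : ∀ s, HasDerivAt g
      ((-2 * ‖W k s‖ ^ 2 + 2 * bigLam ε₀ * ⟪W k s, tableA α (W (k - 1) s)⟫
        - 2 * (bigLam ε₀)⁻¹ * ⟪W (k + 1) s, tableA α (W k s)⟫
        - 2 * viscCoef ε₀ νh k s * ‖W k s‖ ^ 2) / (2 * Real.sqrt (‖W k s‖ ^ 2 + η))) s := by
    intro s
    have h := ((hasDerivAt_norm_sq_visc hW hc k s).add_const η).sqrt (by positivity)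
    simpa only [add_zero] using h
  -- the linear differential inequality for g on [s₀, σ₁]
  have hglin : ∀ s, s₀ ≤ s → s ≤ σ₁ →
      (-2 * ‖W k s‖ ^ 2 + 2 * bigLam ε₀ * ⟪W k s, tableA α (W (k - 1) s)⟫
        - 2 * (bigLam ε₀)⁻¹ * ⟪W (k + 1) s, tableA α (W k s)⟫
        - 2 * viscCoef ε₀ νh k s * ‖W k s‖ ^ 2) / (2 * Real.sqrt (‖W k s‖ ^ 2 + η))
      ≤ -(3 / 4) * g s + (3 / 4) * r + b s := by
    intro s hs1 hs2
    have hlin := deriv_normSq_le_linear (W := W) hε hW.nonneg hc (hback s hs1 hs2)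
    have hg2 : 0 < 2 * Real.sqrt (‖W k s‖ ^ 2 + η) := by positivity
    rw [div_le_iff₀ hg2]
    have e1 : Real.sqrt (‖W k s‖ ^ 2 + η) = g s := rfl
    rw [e1]
    have hgsq : g s ^ 2 = ‖W k s‖ ^ 2 + η := by
      simp only [hg]; rw [Real.sq_sqrt (by positivity)]
    have h1 := hug s
    have h2 := hrg s
    have h3 := hb0 s
    have h4 : η = r ^ 2 := hη
    have hu0 : 0 ≤ ‖W k s‖ := norm_nonneg _
    have hbs : b s = bigLam ε₀ * fluxConst α * ‖W (k - 1) s‖ ^ 2 := rfl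
    rw [← hbs] at hlin
    nlinarith [mul_le_mul_of_nonneg_left h1 h3, mul_le_mul_of_nonneg_left h2 hr0.le, hgpos s]
  -- the antitone functional H(σ) = g σ + (3/4)∫g - ∫b - (3/4) r (σ - s₀)
  set H : ℝ → ℝ := fun σ => g σ + (3 / 4) * (∫ x in s₀..σ, g x) - (∫ x in s₀..σ, b x)
    - (3 / 4) * r * (σ - s₀) with hH
  have hIg : ∀ σ, HasDerivAt (fun u => ∫ x in s₀..u, g x) (g σ) σ := fun σ =>
    integral_hasDerivAt_right (hgcont.intervalIntegrable _ _) (hgcont.stronglyMeasurableAtFilter _ _)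
      hgcont.continuousAt
  have hIb : ∀ σ, HasDerivAt (fun u => ∫ x in s₀..u, b x) (b σ) σ := fun σ =>
    integral_hasDerivAt_right (hbcont.intervalIntegrable _ _) (hbcont.stronglyMeasurableAtFilter _ _)
      hbcont.continuousAt
  have hlinH : ∀ σ, HasDerivAt (fun u : ℝ => (3 / 4) * r * (u - s₀)) ((3 / 4) * r) σ := by
    intro σ
    have h := ((hasDerivAt_id σ).sub_const s₀).const_mul ((3 / 4) * r)
    simpa using h
  have hHderiv : ∀ σ, HasDerivAt H
      ((-2 * ‖W k σ‖ ^ 2 + 2 * bigLam ε₀ * ⟪W k σ, tableA α (W (k - 1) σ)⟫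
        - 2 * (bigLam ε₀)⁻¹ * ⟪W (k + 1) σ, tableA α (W k σ)⟫
        - 2 * viscCoef ε₀ νh k σ * ‖W k σ‖ ^ 2) / (2 * Real.sqrt (‖W k σ‖ ^ 2 + η))
        + (3 / 4) * g σ - b σ - (3 / 4) * r) σ := by
    intro σ
    exact (((hgderiv σ).add ((hIg σ).const_mul (3 / 4))).sub (hIb σ)).sub (hlinH σ)
  have hHdiff : Differentiable ℝ H := fun σ => (hHderiv σ).differentiableAt
  have hHanti : AntitoneOn H (Icc s₀ σ₁) := by
    apply antitoneOn_of_deriv_nonpos (convex_Icc s₀ σ₁) hHdiff.continuous.continuousOn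
      (hHdiff.differentiableOn.mono interior_subset)
    intro x hx
    rw [interior_Icc] at hx
    rw [(hHderiv x).deriv]
    have := hglin x hx.1.le hx.2.le
    linarith
  have hH1 : H σ₁ ≤ H s₀ := hHanti ⟨le_rfl, hs⟩ ⟨hs, le_rfl⟩ hs
  have hHs₀ : H s₀ = g s₀ := by
    simp only [hH, intervalIntegral.integral_same, sub_self, mul_zero, add_zero, sub_zero]
  rw [hHs₀] at hH1
  simp only [hH] at hH1
  -- ∫ u ≤ ∫ g on [s₀, σ₁]
  have hmono : ∫ x in s₀..σ₁, ‖W k x‖ ≤ ∫ x in s₀..σ₁, g x :=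
    intervalIntegral.integral_mono_on hs (hucont.intervalIntegrable _ _) (hgcont.intervalIntegrable _ _)
      fun x _ => hug x
  have hg1 : 0 ≤ g σ₁ := (hgpos σ₁).le
  -- r L = δ
  have hrL : r * L = δ := by rw [hr]; field_simp
  have hfinal : (3 / 4) * ∫ x in s₀..σ₁, ‖W k x‖
      ≤ ‖W k s₀‖ + (∫ x in s₀..σ₁, b x) + r * L := by
    rw [hL]
    nlinarith [hmono, hH1, hgs₀, hg1]
  rw [hrL] at hfinal
  have hbint : ∫ x in s₀..σ₁, b x = bigLam ε₀ * fluxConst α * ∫ x in s₀..σ₁, ‖W (k - 1) x‖ ^ 2 := by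
    simp only [hb]; rw [intervalIntegral.integral_const_mul]
  rw [hbint] at hfinal
  linarith

/-- **Action fence, margin form**: under the backscatter margin `4 C_A ‖W_{k+1}‖ ≤ Λ` on `[s₀, σ₁]`,
`(3/4) ∫_{s₀}^{σ₁} ‖W_k‖ ≤ ‖W_k(s₀)‖ + Λ C_A ∫_{s₀}^{σ₁} ‖W_{k-1}‖²`.
[cite: Tao2016AveragedNS, §4 (4.1), (4.3), Lemma 4.1 (4.8); §6.4] -/
theorem action_le_slaved (hε : 0 < ε₀) (hW : IsEternalVisc ε₀ νh α W) (hc : IsCancellingCoeff α)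
    {k : ℤ} {s₀ σ₁ : ℝ} (hs : s₀ ≤ σ₁)
    (hmar : ∀ s, s₀ ≤ s → s ≤ σ₁ → 4 * fluxConst α * ‖W (k + 1) s‖ ≤ bigLam ε₀) :
    (3 / 4) * ∫ s in s₀..σ₁, ‖W k s‖
      ≤ ‖W k s₀‖ + bigLam ε₀ * fluxConst α * ∫ s in s₀..σ₁, ‖W (k - 1) s‖ ^ 2 := by
  have hS := table_sTable α hc
  have hΛ : 0 < bigLam ε₀ := bigLam_pos (by linarith)
  refine action_le_of_halfBack hε hW hc hs fun s hs1 hs2 => ?_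
  set u : ℝ := ‖W k s‖ with hu
  have hback : -⟪W (k + 1) s, tableA α (W k s)⟫ ≤ ‖W (k + 1) s‖ * (fluxConst α * u ^ 2) := by
    calc -⟪W (k + 1) s, tableA α (W k s)⟫ ≤ |⟪W (k + 1) s, tableA α (W k s)⟫| := neg_le_abs _
      _ ≤ ‖W (k + 1) s‖ * ‖tableA α (W k s)‖ := abs_real_inner_le_norm _ _
      _ ≤ ‖W (k + 1) s‖ * (fluxConst α * u ^ 2) :=
          mul_le_mul_of_nonneg_left (hS.normA _) (norm_nonneg _)
  have h3 : fluxConst α * ‖W (k + 1) s‖ ≤ bigLam ε₀ / 4 := by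
    rw [le_div_iff₀ (by norm_num : (0:ℝ) < 4)]; linarith [hmar s hs1 hs2]
  have h1 : -(2 * (bigLam ε₀)⁻¹ * ⟪W (k + 1) s, tableA α (W k s)⟫)
      ≤ 2 * (bigLam ε₀)⁻¹ * (‖W (k + 1) s‖ * (fluxConst α * u ^ 2)) := by
    have := mul_le_mul_of_nonneg_left hback (by positivity : (0:ℝ) ≤ 2 * (bigLam ε₀)⁻¹)
    linarith
  refine h1.trans ?_
  have h4 : 2 * (bigLam ε₀)⁻¹ * (‖W (k + 1) s‖ * (fluxConst α * u ^ 2))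
      = (2 * (bigLam ε₀)⁻¹ * (fluxConst α * ‖W (k + 1) s‖)) * u ^ 2 := by ring
  rw [h4]
  have h5 : 2 * (bigLam ε₀)⁻¹ * (fluxConst α * ‖W (k + 1) s‖) ≤ 2 * (bigLam ε₀)⁻¹ * (bigLam ε₀ / 4) :=
    mul_le_mul_of_nonneg_left h3 (by positivity)
  have h6 : 2 * (bigLam ε₀)⁻¹ * (bigLam ε₀ / 4) = 1 / 2 := by field_simp; ring
  calc 2 * (bigLam ε₀)⁻¹ * (fluxConst α * ‖W (k + 1) s‖) * u ^ 2
      ≤ 2 * (bigLam ε₀)⁻¹ * (bigLam ε₀ / 4) * u ^ 2 := mul_le_mul_of_nonneg_right h5 (by positivity)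
    _ = ‖W k s‖ ^ 2 / 2 := by rw [h6, hu]; ring

/-- **Action fence, upward-flux form**: if the bond above shell `k` does not backscatter on `[s₀, σ₁]`
(`⟪W_{k+1}, A W_k⟫ ≥ 0`; automatic on strong-orthant tables), then
`(3/4) ∫_{s₀}^{σ₁} ‖W_k‖ ≤ ‖W_k(s₀)‖ + Λ C_A ∫_{s₀}^{σ₁} ‖W_{k-1}‖²`.
[cite: Tao2016AveragedNS, §1.2, §4 (4.1), (4.3), Lemma 4.1 (4.8)–(4.9); §6.4] -/
theorem action_le_slaved_of_flux_nonneg (hε : 0 < ε₀) (hW : IsEternalVisc ε₀ νh α W)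
    (hc : IsCancellingCoeff α) {k : ℤ} {s₀ σ₁ : ℝ} (hs : s₀ ≤ σ₁)
    (hflux : ∀ s, s₀ ≤ s → s ≤ σ₁ → 0 ≤ ⟪W (k + 1) s, tableA α (W k s)⟫) :
    (3 / 4) * ∫ s in s₀..σ₁, ‖W k s‖
      ≤ ‖W k s₀‖ + bigLam ε₀ * fluxConst α * ∫ s in s₀..σ₁, ‖W (k - 1) s‖ ^ 2 := by
  have hΛ : 0 < bigLam ε₀ := bigLam_pos (by linarith)
  refine action_le_of_halfBack hε hW hc hs fun s hs1 hs2 => ?_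
  have h1 : 0 ≤ 2 * (bigLam ε₀)⁻¹ * ⟪W (k + 1) s, tableA α (W k s)⟫ := by
    have := hflux s hs1 hs2; positivity
  have h2 : 0 ≤ ‖W k s‖ ^ 2 / 2 := by positivity
  linarith

/-! ## Large action forces the shell below to be loud -/

/-- **A BOND IS EXPENSIVE ONLY IF THE SHELL BELOW IS LOUD.**  In the setting of `action_le_of_halfBack`, if
`‖W_{k-1}‖ ≤ M` on `[s₀, σ₁]`, then
`(3/4) ∫_{s₀}^{σ₁} ‖W_k‖ ≤ ‖W_k(s₀)‖ + Λ C_A · M · ∫_{s₀}^{σ₁} ‖W_{k-1}‖`: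
the action of shell `k` on a window is paid by `M_{k-1} ×` the action of shell `k-1` — on a quiet tail the
actions decay super-exponentially up the ladder, and a shell whose successor carries action `A_k` has reached
amplitude `≥ ((3/4)A_k - ‖W_k(s₀)‖)/(Λ C_A A_{k-1})`.
[cite: Tao2016AveragedNS, §4 (4.1), (4.3), Lemma 4.1 (4.8); §5 (transit times); §6.4] -/
theorem action_le_sup_mul_action (hε : 0 < ε₀) (hW : IsEternalVisc ε₀ νh α W) (hc : IsCancellingCoeff α)
    {k : ℤ} {s₀ σ₁ M : ℝ} (hs : s₀ ≤ σ₁)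
    (hM : ∀ s, s₀ ≤ s → s ≤ σ₁ → ‖W (k - 1) s‖ ≤ M)
    (hback : ∀ s, s₀ ≤ s → s ≤ σ₁ →
      -(2 * (bigLam ε₀)⁻¹ * ⟪W (k + 1) s, tableA α (W k s)⟫) ≤ ‖W k s‖ ^ 2 / 2) :
    (3 / 4) * ∫ s in s₀..σ₁, ‖W k s‖
      ≤ ‖W k s₀‖ + bigLam ε₀ * fluxConst α * M * ∫ s in s₀..σ₁, ‖W (k - 1) s‖ := by
  have hΛ : 0 < bigLam ε₀ := bigLam_pos (by linarith)
  have hCA : 0 ≤ fluxConst α := fluxConst_nonneg α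
  have hcont : Continuous (W (k - 1)) :=
    continuous_iff_continuousAt.2 fun x => (hW.law (k - 1) x).continuousAt
  have h1 := action_le_of_halfBack hε hW hc hs hback
  have h2 : ∫ s in s₀..σ₁, ‖W (k - 1) s‖ ^ 2 ≤ ∫ s in s₀..σ₁, M * ‖W (k - 1) s‖ := by
    refine intervalIntegral.integral_mono_on hs ((hcont.norm.pow 2).intervalIntegrable _ _)
      ((continuous_const.mul hcont.norm).intervalIntegrable _ _) fun x hx => ?_
    calc ‖W (k - 1) x‖ ^ 2 = ‖W (k - 1) x‖ * ‖W (k - 1) x‖ := sq _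
      _ ≤ M * ‖W (k - 1) x‖ := mul_le_mul_of_nonneg_right (hM x hx.1 hx.2) (norm_nonneg _)
  rw [intervalIntegral.integral_const_mul] at h2
  have h3 : bigLam ε₀ * fluxConst α * ∫ s in s₀..σ₁, ‖W (k - 1) s‖ ^ 2
      ≤ bigLam ε₀ * fluxConst α * (M * ∫ s in s₀..σ₁, ‖W (k - 1) s‖) :=
    mul_le_mul_of_nonneg_left h2 (by positivity)
  linarith

end Summit.NavierStokesRegularity.NavierStokesRegularity.Theorems.NoSurvivingEternalViscBddOne.TailBarrier

end
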